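import Summits.CriticalPhenomena.CardyFormulaZ2.Theses.CardyComplexCone
import Literature.Probability.Percolation.InterfaceCurvesBridge
import Literature.Probability.Percolation.BoxCrossingJordan
import Literature.Probability.LatticeModels.UnitDiscDiscretisation
import Literature.Probability.LatticeModels.DobrushinDiscretisationBridge
import Literature.Probability.Process.KolmogorovExtensionProofs

/-!
# Disproof work file — crux `SLESixFamiliesGiveCardy` (stmt-CriticalPhenomena-9654), cycle 2

Standing adversary's Lean record (refuter `cdisprove`, generation 2).  Prose only in docstrings.
The crux (route `CardyComplexCone`, rank 6; shared as support by `CardySusyWard`,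
`CardySublatticeCoherence`) is

  `SLE6Families → CardyFormulaZ2`,   `SLE6Families` := "for every Dobrushin domain `D` and every
  admissible discretisation family `Λ` of `D` (six unbundled `ZdDiscretisationFamily` fields) the
  endpoint-oriented medial exploration interface of bond percolation at `p = 1/2` converges in law
  to chordal SLE₆ in `D`" (= the registered open conjecture `SLE6LimitZ2AllDiscretisations`).

## Findings of generation 1 (evidence `20260815T223824Z-Disproof.lean`, sha 648ca5f7…, and
`NegativeHitting.lean`, sha d99a383e…; not repeated here, cited by name)

* `not_crux_iff` : `¬ crux ↔ SLE6Families ∧ ¬ CardyFormulaZ2` — a refutation is a proof of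
  Smirnov's SLE₆-on-`ℤ²` conjecture plus a refutation of the audited conjunct; the conjunct is not
  junk-refutable (`summit_clusterPt_mem_Ioo`: every cluster point of the crossing probabilities lies
  in `(0,1)`, tree RSW theorem `discreteCrossingProb_clusterPt_mem_Ioo_holds`).
* antecedent non-vacuous (`familyHyps_discData`), `crux_iff_summit_of_noFamilies`,
  `crux_of_chordTransfer` (families at chord domains + a one-domain transfer ⇒ crux).
* natural strengthening REFUTED: the naive transfer "interfaces → SLE₆ in law ⇒ hitting
  probabilities converge" fails (`hitsBefore_not_isOpen/_not_isClosed`, `not_naiveHittingTransfer`,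
  `disc_hitting_prob_eq_zero`, `not_interfaceHittingTransfer`): the crossing event must be the
  lattice event `discreteCrossing`, compared through open `hitsBeforeApprox` neighbourhoods.
* prover skeleton with liminf bounds only (`crossing_limit_of_two_liminf_bounds`, `crossRatio_swap13`).

## Findings of cycle 2 (this file; job ids refer to `kit compute` evidence on the item)

* §1 `crux_iff`, `sle6Families_iff_conjecture`, `crux_iff_conjecture`, `not_crux_iff`,
  `crux_of_not_sle6Families`, `crux_of_cardy` — logical shape, re-certified against the rev-3
  route file (the inline interface map IS `Interface.bondInterfaceIn`, by `rfl`).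
* §2 VACUITY CHANNELS of the antecedent, made explicit:
  - `familyHyps_discData` — the six guards are jointly satisfiable (tree: tilted-arc disc family);
  - `isProbabilityMeasure_preWienerMeasure` — the SLE probability space is not the junk measure `0`
    (Kolmogorov extension PROVED in tree), so `TendstoLaw` to an SLE curve is a genuine constraint;
  - `interfaceMap_of_exploration_nil`, `not_tendstoLaw_of_frequently_junk`,
    `sle6Families_false_of_frequently_junk` — the ONLY remaining way for `SLE6Families` to be
    junk-false (and the crux vacuously true) is a failure, with non-vanishing probability along an
    admissible family, of the unproved well-definedness fact `existsUnique_medialExploration`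
    (then `medialExploration = []`, the interface is the class of the constant curve `0`, and the
    target functional `min 1 (dist target b)` separates it from every SLE₆ law, whose curves end at
    `b` by `IsCompactifiedImage`).  The simulation (`job_dict/main.py`, a line-by-line Python
    transcription of `cornerSource`/`cornerTarget`/`IsMedialTurn`, inner faces, arc-`A`-on-the-left
    start, `zdDiscreteArc`, `bcBondConfig`) traced ≈ 7·10⁵ configurations of admissible square /
    2:1-rectangle data at meshes 1/4 … 1/16 in local smoke runs: unique continuation at every step,
    no repeated dart, termination exactly at the other `A`–`B` edge, in 100 % of the samples — no
    junk — ALSO on the unit DISC (`job_dict/disc.py`: tilted admissible arcs, marks `1, i, −1, −i`),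
    whose discretisation has many CONCAVE lattice corners (`zdBoundary ⊋ meshBoundary`, 4 … 292 such
    sites at meshes 1/4 … 1/128, the case `MedialInterface.lean` singles out): admissibility (no ties,
    exactly two `A`–`B` edges, each with one inner face) verified at every mesh 1/4 … 1/128, and all
    ≈ 10⁴ traced disc configurations (meshes 1/4 … 1/12) well defined.  The definitive runs (square to
    mesh 1/256 with exact enumeration at 1/4, 1/5: kit job j006753; disc to 1/128: kit job j007147)
    were queued behind higher-priority work at the time of writing; their summaries + stdout tables
    are attached to the item by the compute daemon when they end, and will be copied here.
* §2b ORIENTATION IS LOAD-BEARING (certified): `source_sle_ae` / `target_sle_ae` (SLE curves of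
  `D` run from `a` to `b` a.s.), `not_tendstoLaw_of_source_eq_target`, and
  `orientation_loadBearing : SLE6Families → ¬ SLE6FamiliesRev` (endpoint rule with branches
  swapped is refuted under the antecedent; witness = the tree's disc family).
* §3 THE DISCRETE DICTIONARY (why-might-fail #1 of the item), measured and sharpened:
  - `ExactDictionary` (typed `Prop`, the `→` half, valid for ANY splitting of the arcs; PROVED
    in §4 as `exactDictionary_holds`): the Dobrushin hitting event `H` = "oriented interface touches
    `(cd)_δ` before `(bc)_δ`" implies a WIRED crossing event `C₁'` (arc-`(ab)` sites joined by
    `bcBondConfig`-open edges, avoiding `(bc)`-sites, to a neighbour of a `(cd)`-site); for ARC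
    splittings the converse (planar barrier argument) holds too and `H = C₁'` was tested EXACT —
    0 mismatches in ≈ 7·10⁵ locally traced configurations (j006753 extends to mesh 1/256).
  - the FREE crossing event `C₁ = discreteCrossing` of the summit differs from `H` on a set of
    configurations of probability ≈ 1.45·δ on the unit square (EXACT value 1504/4096 = 0.367 at
    δ = 1/4 by enumeration of the 2¹² configurations; Monte-Carlo `n·P(C₁ xor H)` = 1.47, 1.51,
    1.46, 1.67±0.13, 1.40±0.07 at n = 1/δ = 5, 6, 8, 12, 16 with 4·10⁵ … 10³ samples; j006753 extends
    the table to δ = 1/256): the identification error is O(δ), carried by boundary 3-arm events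
    along the four sides — it is `o(1)`, as the intended proof needs, and apparently no more.
    `P(H)` itself is 1/2 to sampling accuracy at every mesh on the square (exactly 2048/4096 at
    δ = 1/4: a diagonal-reflection + duality symmetry of the Dobrushin data), `P(C₁) − 1/2 ≈ 0.7 δ`.
    On the DISC (no such symmetry): `n·P(C₁ xor H)` = 1.22, 1.23, 1.40, 1.54 at n = 4, 6, 8, 12
    (3·10³ … 10³ samples), 0 mismatches `H` vs `C₁'`, `P(H)` = 0.37, 0.44, 0.45, 0.47 ↑ 1/2 and
    `P(C₁)` = 0.62, 0.57, 0.56, 0.54 ↓ 1/2 (Cardy value 1/2 at cross-ratio 1/2).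
  - ORIENTATION IS LOAD-BEARING: for the square family the tree's exploration (arc `A` on the left
    of the first step) starts at the `A`–`B` edge at `pt 1 = c` and ends at `pt 0 = a` (column `rev`
    of the simulation output; parity rule: the valid start is the `A → B` transition in the counter-clockwise
    traversal of the face domain, i.e. at `pt 1` for counter-clockwise boundary parametrisations and at
    `pt 0` for clockwise ones — `JordanDomain` fixes no orientation, so both occur); without
    `orientCurve` the antecedent would be false by the target functional.  Provers must keep the
    orientation case split.
  - DUALITY-STEP JUNK: `P(C₁) + P(C₂) − 1 = P(C₁ ∩ C₂) − P(C₁ᶜ ∩ C₂ᶜ)` (`prob_add_prob_eq`) for the two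
    free crossings of a conformal rectangle; measured ≈ +1.5·δ on the square.  An upper bound
    `p + q ≤ 1 + ε` for FREE crossings is therefore an open-plus vs closed-plus comparison, not lattice
    duality; gen-1's skeleton must take `q` = the closed-DUAL conjugate crossing (exact duality) or,
    simpler, the complementary first-touch event of the SAME interface of `(Ω; a, c)`
    (`limit_of_liminf_of_compl`), for which `p + q ≤ 1` is automatic.

* §4 `exactDictionary_holds : ExactDictionary` — the `→` half of the dictionary is PROVED from the
  definitions (std axioms): `isCorner_eq_of_cornerSource_eq_of_cornerTarget_eq_holds` discharges the
  named bookkeeping fact of `MedialInterface.lean`; `left_chain`, `left_reachable` (left-cluster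
  induction), `not_mem_zdArcB_of_reachable`, `domAdj_of_isMedialStep`; provers may land them.

## Literature anchors for provers (cycle 2)

* Left/right cluster property of the exploration ("white path on the left and a black path on the
  right"): Grimmett, *Probability on Graphs* (2nd ed. 2018), §5.7, p. 179 (Fig. 5.17) — the `𝕋`
  statement of `left_reachable`.
* Boundary-layer control and discretisation classes for GENERAL domains: Binder–Chayes–Lei, *On
  convergence to SLE₆ II: discrete approximations and extraction of Cardy's formula for general
  domains*, J. Stat. Phys. 141 (2010), arXiv:1004.4676 — §3 Def. 3.1 (interior approximations;
  the tree's largest-component / closed-edge / distance-rule recipe is of this type for Jordan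
  carriers), Example 3.3 (canonical approximation), §5 Lemma 5.2 (boundary values via Harris
  circuits in conformal annuli — the "plane annulus circuits" defusing the rough-prime-end worry).

## Note for item 9644 (DiscretisationFamilyExists), from the admissibility bookkeeping

A neck of the face domain exactly ONE face wide contains interior edges ("chords", two inner faces)
joining its two walls; if the walls carry different labels these chords are extra `A`–`B` edges and
violate `ncard_zdABEdges_eq_two` / `zdABEdges_inner`.  Since the exploration would have to traverse
such a neck with `A` on one wall and `B` on the other, admissible data must place the far `A`/`B`
transition BEFORE any one-face-wide stretch (labelling everything beyond it monochromatically — a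
dead-end pocket the interface never enters).  For a fixed Jordan carrier one-face-wide necks at
small mesh occur only inside cusps/filaments of width `< 4δ`, whose diameter tends to `0`, so the
Hausdorff requirements survive; but a construction for 9644 must do this explicitly (the arcs of
`DiscreteDobrushin` are free subsets of `ℂ`, which gives the needed freedom).

## Why the crux resists (cycle 2 verdict)

Unchanged and sharpened: `¬ crux` needs `SLE6Families` PROVED; the antecedent is the genuine
conjecture (guards satisfiable, exploration well defined on every sampled configuration, SLE₆ curves
exist); the conclusion is the audited conjunct with cluster points in `(0,1)`; the load-bearing
discrete dictionary is exact in its wired form and `O(δ)`-close to the free crossing event.  No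
Lean refutation exists; every junk channel inspected is closed.  The remaining risks are PROOF
risks (volume): families at every chord domain (item 9644), RSW control of the `O(δ)` boundary
layer for general Jordan boundaries (plane annulus circuits suffice), portmanteau on open
approximations + a.s. continuity / liminf-only bookkeeping.
-/

noncomputable section

open MeasureTheory Filter Set Topology
open scoped unitInterval ENNReal NNReal
open Literature.Probability.Percolation Literature.Probability.LatticeModels
open Literature.Probability.RandomPlanarGeometry
open Summit.CriticalPhenomena.CardyFormulaZ2.Theses.CardyComplexCone

namespace Summit.CriticalPhenomena.CardyFormulaZ2.Cruxes.SLESixFamiliesGiveCardy.Disproof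

/-! ### §1 Logical shape of the crux -/

/-- The interface map of the crux at data `E` (verbatim the inline lambda of the route file):
the class of the endpoint-oriented medial exploration curve. -/
def interfaceMap (D : DobrushinDomain) (E : DiscreteDobrushin) (ω : BondConfig (Site 2)) :
    CurveClass ℂ :=
  CurveClass.mk (if dist (medialExplorationCurve E ω 0) (D.pt 0) ≤
      dist (medialExplorationCurve E ω 0) (D.pt 1) then
    (⟨medialExplorationCurve E ω⟩ : Curve ℂ)
    else ⟨(medialExplorationCurve E ω).comp ⟨unitInterval.symm, unitInterval.continuous_symm⟩⟩)

/-- The inline interface map IS the fact-free `Interface.bondInterfaceIn` (definitionally). -/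
theorem interfaceMap_eq_bondInterfaceIn (D : DobrushinDomain) (E : DiscreteDobrushin) :
    interfaceMap D E = Interface.bondInterfaceIn D E := rfl

/-- The antecedent of the crux: SLE₆ for every Dobrushin domain and every discretisation family
(six `ZdDiscretisationFamily` fields, unbundled), verbatim. -/
def SLE6Families : Prop :=
  ∀ (D : DobrushinDomain) (Λ : ℝ → DiscreteDobrushin), (∀ δ, (Λ δ).Ω = D.carrier) →
    (∀ δ, (Λ δ).δ = δ) →
    Tendsto (fun δ : ℝ => Metric.hausdorffEDist (Λ δ).arcA (D.arc 0)) (𝓝[>] (0:ℝ)) (𝓝 0) →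
    Tendsto (fun δ : ℝ => Metric.hausdorffEDist (Λ δ).arcB (D.arc 1)) (𝓝[>] (0:ℝ)) (𝓝 0) →
    Tendsto (fun δ : ℝ => Metric.hausdorffEDist (medialPoint δ '' (Λ δ).zdABEdges) {D.pt 0, D.pt 1})
      (𝓝[>] (0:ℝ)) (𝓝 0) →
    (∀ᶠ δ in 𝓝[>] (0:ℝ), (Λ δ).IsZdAdmissible) →
    ConvergesInLawToSLE 6 D (Ωδ := fun _ => BondConfig (Site 2)) (fun δ ω => interfaceMap D (Λ δ) ω)
      (fun _ => bondPercolation (zdGraph 2) half)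

/-- The crux is literally `SLE6Families → CardyFormulaZ2`. -/
theorem crux_iff : SLESixFamiliesGiveCardy ↔ (SLE6Families → _root_.CardyFormulaZ2) := Iff.rfl

/-- The unbundled antecedent is the registered open conjecture `SLE6LimitZ2AllDiscretisations`
(Smirnov, ICM 2006, Conj. 4 at `q = 1`, family form). -/
theorem sle6Families_iff_conjecture :
    SLE6Families ↔ Summit.CriticalPhenomena.CardyFormulaZ2.SLE6LimitZ2AllDiscretisations := by
  rw [sle6LimitZ2AllDiscretisations_iff_interface]
  constructor
  · intro h D E hE
    exact h D E hE.Ω_eq hE.δ_eq hE.tendsto_arcA hE.tendsto_arcB hE.tendsto_zdABEdges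
      hE.eventually_isZdAdmissible
  · intro h D Λ h1 h2 h3 h4 h5 h6
    exact h D Λ ⟨h1, h2, h3, h4, h5, h6⟩

/-- Hence the crux is `SLE6LimitZ2AllDiscretisations → CardyFormulaZ2`. -/
theorem crux_iff_conjecture :
    SLESixFamiliesGiveCardy ↔
      (Summit.CriticalPhenomena.CardyFormulaZ2.SLE6LimitZ2AllDiscretisations →
        _root_.CardyFormulaZ2) := by
  rw [crux_iff, sle6Families_iff_conjecture]

/-- OBSTRUCTION TO DISPROOF: refuting the crux means PROVING the SLE₆ conjecture on `ℤ²` and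
refuting the audited summit conjunct. -/
theorem not_crux_iff : ¬ SLESixFamiliesGiveCardy ↔ (SLE6Families ∧ ¬ _root_.CardyFormulaZ2) := by
  rw [crux_iff]; tauto

/-- Vacuity channel 1: were the antecedent false (for junk or for mathematics), the crux would be
trivially TRUE — and the upstream crux `ParafermionToSLESixFamilies` (stmt-11389), which
concludes it, would carry the whole weight. -/
theorem crux_of_not_sle6Families (h : ¬ SLE6Families) : SLESixFamiliesGiveCardy :=
  fun h' => (h h').elim

/-- Vacuity channel 2: the crux follows from the conjunct itself. -/
theorem crux_of_cardy (h : _root_.CardyFormulaZ2) : SLESixFamiliesGiveCardy := fun _ => h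

/-- The conjunct is not junk-refutable through degenerate discretisations: every cluster point at
`0⁺` of the bond crossing probabilities of every conformal rectangle lies in `(0,1)` (tree theorem,
RSW + FKG + bulk property of the largest-component discretisation).  A refutation of the conjunct
must therefore exhibit oscillation or a wrong limit INSIDE `(0,1)`. -/
theorem summit_clusterPt_mem_Ioo (R : ConformalRectangle) {c : ℝ}
    (hc : MapClusterPt c (𝓝[>] 0) (bondDomainCrossingProb R)) : c ∈ Set.Ioo 0 1 :=
  discreteCrossingProb_clusterPt_mem_Ioo_holds R hc

/-! ### §2 Vacuity channels of the antecedent -/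

/-- The six guards of the antecedent are jointly satisfiable: the tilted-arc discretisation family
of the unit disc (tree construction, all fields proved). -/
theorem familyHyps_discData :
    ZdDiscretisationFamily DobrushinDomain.unitDisc UnitDiscDiscretisation.discData :=
  UnitDiscDiscretisation.isDiscretisation_discData.toZdDiscretisationFamily

/-- So `SLE6Families` has at least one genuine instance to answer for: it is not vacuously true. -/
theorem sle6Families_instance (h : SLE6Families) :
    ConvergesInLawToSLE 6 DobrushinDomain.unitDisc (Ωδ := fun _ => BondConfig (Site 2))
      (fun δ ω => interfaceMap DobrushinDomain.unitDisc (UnitDiscDiscretisation.discData δ) ω)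
      (fun _ => bondPercolation (zdGraph 2) half) :=
  h _ _ familyHyps_discData.Ω_eq familyHyps_discData.δ_eq familyHyps_discData.tendsto_arcA
    familyHyps_discData.tendsto_arcB familyHyps_discData.tendsto_zdABEdges
    familyHyps_discData.eventually_isZdAdmissible

/-- JUNK BRANCH of G02's exploration: if the exploration list is `[]` (which is what
`medialExploration` returns whenever there is NOT exactly one exploration path), the exploration
curve is the constant curve `0`. -/
theorem medialExplorationCurve_of_nil (E : DiscreteDobrushin) (ω : BondConfig (Site 2))
    (h : medialExploration E ω = []) : medialExplorationCurve E ω = ContinuousMap.const _ 0 := by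
  simp [medialExplorationCurve, h]

theorem reverse_const (x : ℂ) :
    (ContinuousMap.const unitInterval x).comp
        ⟨unitInterval.symm, unitInterval.continuous_symm⟩ = ContinuousMap.const unitInterval x := by
  ext t; simp

/-- … and then the interface map of the crux is the class of the constant curve `0`, whatever the
configuration and the Dobrushin domain. -/
theorem interfaceMap_of_exploration_nil (D : DobrushinDomain) (E : DiscreteDobrushin)
    (ω : BondConfig (Site 2)) (h : medialExploration E ω = []) :
    interfaceMap D E ω = CurveClass.mk (Curve.const 0) := by
  unfold interfaceMap
  rw [medialExplorationCurve_of_nil E ω h]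
  split_ifs with hle
  · rfl
  · rw [reverse_const]; rfl

/-- The bounded continuous test functional `γ ↦ min 1 (dist γ.target p)`. -/
def targetDistBCF (p : ℂ) : BoundedContinuousFunction (CurveClass ℂ) ℝ :=
  BoundedContinuousFunction.ofNormedAddCommGroup (fun γ => min 1 (dist γ.target p))
    (continuous_const.min (CurveClass.continuous_target.dist continuous_const)) 1
    (fun γ => by
      rw [Real.norm_eq_abs, abs_of_nonneg (le_min zero_le_one dist_nonneg)]
      exact min_le_left _ _)

@[simp] theorem targetDistBCF_apply (p : ℂ) (γ : CurveClass ℂ) :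
    targetDistBCF p γ = min 1 (dist γ.target p) := rfl

theorem targetDistBCF_nonneg (p : ℂ) (γ : CurveClass ℂ) : 0 ≤ targetDistBCF p γ :=
  le_min zero_le_one dist_nonneg

/-- Under an SLE law the target functional integrates to `0`: SLE curves END at `b = D.pt 1`
(the endpoint clause of `IsCompactifiedImage`, no trace theory needed). -/
theorem integral_targetDistBCF_sle {κ : NNReal} {D : DobrushinDomain}
    {Γ : (NNReal → ℝ) → CurveClass ℂ} (hΓ : IsSLECurve κ D Γ) :
    ∫ ω, targetDistBCF (D.pt 1) (Γ ω) ∂Literature.Probability.Process.preWienerMeasure = 0 := by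
  apply integral_eq_zero_of_ae
  obtain ⟨-, φ, -, hae⟩ := hΓ
  filter_upwards [hae] with ω hω
  obtain ⟨-, c, hc, hcomp⟩ := hω
  have ht : (Γ ω).target = D.pt 1 := by
    rw [hc, CurveClass.target_mk, Curve.target_def]
    exact hcomp.2
  simp [ht]

/-- JUNK CHANNEL, quantified: if along a family `X δ` of `CurveClass`-valued maps under probability
laws the curves are the junk class `mk (const 0)` on events of probability NOT tending to `0`
(precisely: `∃ η > 0`, frequently `P δ {junk} ≥ η`; `X δ` measurable eventually), and `0 ≠ b`,
then `X` does not converge in law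
(`TendstoLaw`) to any random curve ending a.s. at `b` — in particular to no SLE curve of a
Dobrushin domain with `pt 1 = b`.  (Test functional `min 1 (dist target b)`.) -/
theorem not_tendstoLaw_of_frequently_junk {Ωδ : ℝ → Type*} [∀ δ, MeasurableSpace (Ωδ δ)]
    (X : ∀ δ, Ωδ δ → CurveClass ℂ) (P : ∀ δ, Measure (Ωδ δ)) [∀ δ, IsProbabilityMeasure (P δ)]
    (hX : ∀ᶠ δ in 𝓝[>] (0 : ℝ), Measurable (X δ))
    {κ : NNReal} {D : DobrushinDomain} {Γ : (NNReal → ℝ) → CurveClass ℂ} (hΓ : IsSLECurve κ D Γ)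
    (hb : D.pt 1 ≠ 0) {η : ℝ} (hη : 0 < η)
    (hjunk : ∃ᶠ δ in 𝓝[>] (0 : ℝ),
      η ≤ (P δ).real {ω | X δ ω = CurveClass.mk (Curve.const 0)}) :
    ¬ TendstoLaw X P Γ Literature.Probability.Process.preWienerMeasure := by
  intro hT
  set f := targetDistBCF (D.pt 1) with hf
  have hlim := hT f
  rw [integral_targetDistBCF_sle hΓ] at hlim
  -- the value of `f` on the junk class
  set m : ℝ := min 1 (dist (0 : ℂ) (D.pt 1)) with hm
  have hm_pos : 0 < m := lt_min one_pos (dist_pos.2 hb.symm)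
  have hfjunk : f (CurveClass.mk (Curve.const 0)) = m := by
    rw [hf, targetDistBCF_apply, CurveClass.target_mk, Curve.target_def, Curve.const_apply]
  -- lower bound `η * m ≤ ∫ f (X δ)` frequently
  have hlow : ∃ᶠ δ in 𝓝[>] (0 : ℝ), η * m ≤ ∫ ω, f (X δ ω) ∂P δ := by
    refine (hjunk.and_eventually hX).mono fun δ ⟨hδ, hXδ⟩ => ?_
    have hmeas : MeasurableSet {ω | X δ ω = CurveClass.mk (Curve.const 0)} :=
      hXδ (measurableSet_singleton _)
    calc η * m ≤ (P δ).real {ω | X δ ω = CurveClass.mk (Curve.const 0)} * m :=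
          mul_le_mul_of_nonneg_right hδ hm_pos.le
      _ = ∫ ω in {ω | X δ ω = CurveClass.mk (Curve.const 0)}, m ∂P δ := by
          rw [setIntegral_const, smul_eq_mul]
      _ = ∫ ω in {ω | X δ ω = CurveClass.mk (Curve.const 0)}, f (X δ ω) ∂P δ := by
          refine setIntegral_congr_fun hmeas fun ω hω => ?_
          rw [Set.mem_setOf_eq] at hω
          rw [hω, hfjunk]
      _ ≤ ∫ ω, f (X δ ω) ∂P δ := by
          refine setIntegral_le_integral ?_ (Eventually.of_forall fun ω => targetDistBCF_nonneg _ _)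
          exact Integrable.of_bound (f.continuous.measurable.comp hXδ).aestronglyMeasurable 1
            (Eventually.of_forall fun ω => by
              rw [Real.norm_eq_abs, abs_of_nonneg (targetDistBCF_nonneg _ _)]
              exact min_le_left _ _)
  -- contradiction with the limit `0`
  have hev : ∀ᶠ δ in 𝓝[>] (0 : ℝ), ∫ ω, f (X δ ω) ∂P δ < η * m :=
    (tendsto_order.1 hlim).2 _ (mul_pos hη hm_pos)
  obtain ⟨δ, hδ1, hδ2⟩ := (hlow.and_eventually hev).exists
  exact absurd hδ2 (not_lt.2 hδ1)

/-- Junk channel CLOSED: the pre-Wiener measure (the probability space of every SLE curve in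
`IsSLECurve` / `ConvergesInLawToSLE`) is a genuine probability measure — unconditionally, since the
Kolmogorov extension theorem is PROVED in the tree (`exists_isProjectiveLimit_holds`).  Were it the
junk measure `0`, `TendstoLaw X P Γ 0` would fail for every family of probability laws (test
function `1`), `SLE6Families` would be false and the crux vacuously true. -/
instance isProbabilityMeasure_preWienerMeasure :
    IsProbabilityMeasure Literature.Probability.Process.preWienerMeasure :=
  Literature.Probability.Process.isProbabilityMeasure_preWienerMeasure
    (Literature.Probability.Process.isProjectiveLimit_preWienerMeasure_of
      Literature.Probability.Process.exists_isProjectiveLimit_holds)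

/-- Consequently an SLE law has total mass one, and the constant test function `1` cannot
separate: the only separating functionals are genuinely geometric (endpoints, hitting). -/
theorem integral_one_sle {κ : NNReal} {D : DobrushinDomain} {Γ : (NNReal → ℝ) → CurveClass ℂ}
    (_hΓ : IsSLECurve κ D Γ) :
    ∫ _ω, (1 : ℝ) ∂Literature.Probability.Process.preWienerMeasure = 1 := by
  simp

/-! #### Measurability of the interface map (so that the junk channel below is hypothesis-free)
(after the sibling work file `Cruxes/LagHandOff/Disproof.lean`, reproduced to stay import-free) -/

/-- The boundary-condition-completed configuration only reads the edges of `Ω_δ`. -/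
theorem bcBondConfig_inter_eq (E : DiscreteDobrushin) {S : Set (Sym2 (Site 2))}
    (hS : (discreteDomainGraph E.Ω E.δ).edgeSet ⊆ S) (ω : BondConfig (Site 2)) :
    E.bcBondConfig (ω ∩ S) = E.bcBondConfig ω := by
  ext e
  simp only [DiscreteDobrushin.mem_bcBondConfig_iff, Set.mem_inter_iff]
  constructor
  · rintro ⟨he, h | ⟨⟨hω, -⟩, hB⟩⟩
    · exact ⟨he, Or.inl h⟩
    · exact ⟨he, Or.inr ⟨hω, hB⟩⟩
  · rintro ⟨he, h | ⟨hω, hB⟩⟩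
    · exact ⟨he, Or.inl h⟩
    · exact ⟨he, Or.inr ⟨⟨hω, hS he⟩, hB⟩⟩

/-- Exploration paths only depend on the completed configuration. -/
theorem isMedialExploration_congr (E : DiscreteDobrushin) {ω ω' : BondConfig (Site 2)}
    (h : E.bcBondConfig ω = E.bcBondConfig ω') (γ : List MedialVertex) :
    IsMedialExploration E ω γ ↔ IsMedialExploration E ω' γ := by
  constructor
  · intro hγ
    exact { ne_nil := hγ.ne_nil, step := hγ.step, turn := h ▸ hγ.turn, nodup := hγ.nodup,
            head_mem := hγ.head_mem, getLast_mem := hγ.getLast_mem,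
            head_ne_getLast := hγ.head_ne_getLast, start := hγ.start }
  · intro hγ
    exact { ne_nil := hγ.ne_nil, step := hγ.step, turn := h.symm ▸ hγ.turn, nodup := hγ.nodup,
            head_mem := hγ.head_mem, getLast_mem := hγ.getLast_mem,
            head_ne_getLast := hγ.head_ne_getLast, start := hγ.start }

/-- Hence so does G02's exploration path (junk branch included). -/
theorem medialExploration_congr (E : DiscreteDobrushin) {ω ω' : BondConfig (Site 2)}
    (h : E.bcBondConfig ω = E.bcBondConfig ω') :
    medialExploration E ω = medialExploration E ω' := by
  classical
  have hP : IsMedialExploration E ω = IsMedialExploration E ω' :=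
    funext fun γ => propext (isMedialExploration_congr E h γ)
  unfold medialExploration
  exact congrArg (fun P : List MedialVertex → Prop =>
    if hp : ∃! γ, P γ then hp.exists.choose else ([] : List MedialVertex)) hP

/-- MEASURABILITY of the interface map for data with finitely many domain edges: it factors
through the restriction to the finite edge set of `Ω_δ`. -/
theorem measurable_interfaceMap (D : DobrushinDomain) (E : DiscreteDobrushin)
    (hfin : (discreteDomainGraph E.Ω E.δ).edgeSet.Finite) :
    Measurable (interfaceMap D E) := by
  set S := (discreteDomainGraph E.Ω E.δ).edgeSet with hSdef
  haveI : Finite S := hfin.to_subtype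
  let restr : BondConfig (Site 2) → Set S := fun ω => {e | (e : Sym2 (Site 2)) ∈ ω}
  let extd : Set S → BondConfig (Site 2) := fun c => {e | ∃ h : e ∈ S, (⟨e, h⟩ : S) ∈ c}
  have hrestr : Measurable restr := measurable_set_iff.2 fun e => measurable_set_mem _
  have hext : ∀ ω, extd (restr ω) = ω ∩ S := by
    intro ω; ext e
    simp only [extd, restr, Set.mem_setOf_eq, Set.mem_inter_iff]
    constructor
    · rintro ⟨h, h'⟩; exact ⟨h', h⟩
    · rintro ⟨h', h⟩; exact ⟨h, h'⟩
  have hfac : interfaceMap D E = (fun c => interfaceMap D E (extd c)) ∘ restr := by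
    funext ω
    simp only [Function.comp_apply, hext]
    unfold interfaceMap medialExplorationCurve
    rw [medialExploration_congr E (bcBondConfig_inter_eq E subset_rfl ω).symm]
  rw [hfac]
  exact (measurable_of_finite _).comp hrestr

/-- For a discretisation family (bounded Jordan carrier) the interface map is measurable at every
positive mesh. -/
theorem measurable_interfaceMap_of_family (D : DobrushinDomain) (Λ : ℝ → DiscreteDobrushin)
    (hΛ : ZdDiscretisationFamily D Λ) {δ : ℝ} (hδ : 0 < δ) :
    Measurable (interfaceMap D (Λ δ)) := by
  refine measurable_interfaceMap D (Λ δ) ?_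
  have hV : (meshDomain (Λ δ).Ω (Λ δ).δ).Finite := hΛ.meshDomain_finite hδ
  refine ((hV.prod hV).image (fun p : Site 2 × Site 2 => s(p.1, p.2))).subset ?_
  intro e he
  induction e using Sym2.ind with
  | _ x y =>
    have hadj := (SimpleGraph.mem_edgeSet _).1 he
    have h := discreteDomainGraph_adj_iff.1 hadj
    exact ⟨(x, y), ⟨h.2.1, h.2.2⟩, rfl⟩

/-- The junk channel in the crux's own setting: if for some Dobrushin domain `D` with `pt 1 ≠ 0`
and some family `Λ` satisfying the six guards the exploration list is EMPTY (junk) on events of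
probability frequently `≥ η > 0` as `δ → 0⁺`, then `SLE6Families` is FALSE (and the crux vacuously
true); no measurability hypothesis (`measurable_interfaceMap_of_family`).  By the docstring of `medialExploration` this happens exactly when the unproved named fact
`existsUnique_medialExploration` fails with non-vanishing probability on admissible data.
The simulation found no such configuration among ≈ 7·10⁵ traced ones (j006753 extends the search). -/
theorem sle6Families_false_of_frequently_junk (D : DobrushinDomain) (hb : D.pt 1 ≠ 0)
    (Λ : ℝ → DiscreteDobrushin) (hΛ : ZdDiscretisationFamily D Λ)
    {η : ℝ} (hη : 0 < η)
    (hjunk : ∃ᶠ δ in 𝓝[>] (0 : ℝ),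
      η ≤ (bondPercolation (zdGraph 2) half).real {ω | medialExploration (Λ δ) ω = []}) :
    ¬ SLE6Families := by
  intro h
  obtain ⟨Γ, hΓ, -, hT⟩ := h D Λ hΛ.Ω_eq hΛ.δ_eq hΛ.tendsto_arcA hΛ.tendsto_arcB
    hΛ.tendsto_zdABEdges hΛ.eventually_isZdAdmissible
  refine not_tendstoLaw_of_frequently_junk (fun δ ω => interfaceMap D (Λ δ) ω)
    (fun _ => bondPercolation (zdGraph 2) half)
    (eventually_nhdsWithin_of_forall fun δ hδ => measurable_interfaceMap_of_family D Λ hΛ hδ)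
    hΓ hb hη ?_ hT
  refine hjunk.mono fun δ hδ => hδ.trans ?_
  refine measureReal_mono (fun ω hω => ?_)
  rw [Set.mem_setOf_eq] at hω ⊢
  exact interfaceMap_of_exploration_nil D (Λ δ) ω hω

/-! ### §2b Orientation is load-bearing (certified)

The crux orients the exploration polyline by the endpoint rule of `orientCurve` (reverse iff the
raw curve starts closer to `b = pt 1` than to `a = pt 0`).  For the square family of the simulation the
tree's exploration (arc `A` on the left of its first step) starts at the `A`–`B` edge at `pt 1`
and the rule reverses it (parity rule: valid start = the `A → B` transition in the
counter-clockwise traversal of the face domain, i.e. at `pt 1` for counter-clockwise boundary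
parametrisations, at `pt 0` for clockwise ones — `JordanDomain` fixes no orientation).  The
theorems below certify that the rule has teeth: SLE curves of `D` start at `a` and end at `b`
almost surely (`source_sle_ae`, `target_sle_ae` — from `Loewner.trace_zero`, the chordal
normalisation and the endpoint clause of `IsCompactifiedImage`), so a family and ANY family of
curves starting where the first one ends (e.g. its time reversal) cannot both converge in law to
SLE curves of `D` (`not_tendstoLaw_of_source_eq_target`); in the crux's setting,
`SLE6Families → ¬ SLE6FamiliesRev` (`orientation_loadBearing`): the antecedent with the two
branches of the endpoint rule swapped is REFUTED under the antecedent itself.  Provers must carry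
the orientation case split; ideators must not "simplify" the rule away. -/

/-- `0 ∈ closure ℍ`. -/
theorem zero_mem_closure_upperHalfPlaneSet : (0 : ℂ) ∈ closure UpperHalfPlane.upperHalfPlaneSet := by
  have : closure UpperHalfPlane.upperHalfPlaneSet = {z : ℂ | 0 ≤ z.im} :=
    Complex.closure_setOf_lt_im 0
  rw [this]
  simp

/-- SLE curves START at `a = D.pt 0` almost surely: the trace starts at the driving point
`W 0 = 0` (`Loewner.trace_zero`, junk case included) and the chordal uniformizing map has
boundary value `a` at `0`. -/
theorem source_sle_ae {κ : ℝ≥0} {D : DobrushinDomain} {Γ : (ℝ≥0 → ℝ) → CurveClass ℂ}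
    (hΓ : IsSLECurve κ D Γ) :
    ∀ᵐ ω ∂Literature.Probability.Process.preWienerMeasure, (Γ ω).source = D.pt 0 := by
  obtain ⟨-, φ, hφ, hae⟩ := hΓ
  filter_upwards [hae] with ω hω
  obtain ⟨-, c, hc, hcomp⟩ := hω
  rw [hc, CurveClass.source_mk, Curve.source_def]
  have h0 : ((0 : I) : ℝ) < 1 := by norm_num
  rw [hcomp.1 0 h0, rayParam_zero]
  have htr : sleTrace κ ω 0 = 0 := by
    rw [sleTrace, Loewner.trace_zero, sleDriving_zero, Complex.ofReal_zero]
  rw [htr]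
  exact φ.boundaryExtension_eq_of_hasBoundaryValue zero_mem_closure_upperHalfPlaneSet hφ.1

/-- SLE curves END at `b = D.pt 1` almost surely (endpoint clause of `IsCompactifiedImage`). -/
theorem target_sle_ae {κ : ℝ≥0} {D : DobrushinDomain} {Γ : (ℝ≥0 → ℝ) → CurveClass ℂ}
    (hΓ : IsSLECurve κ D Γ) :
    ∀ᵐ ω ∂Literature.Probability.Process.preWienerMeasure, (Γ ω).target = D.pt 1 := by
  obtain ⟨-, φ, -, hae⟩ := hΓ
  filter_upwards [hae] with ω hω
  obtain ⟨-, c, hc, hcomp⟩ := hω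
  rw [hc, CurveClass.target_mk, Curve.target_def]
  exact hcomp.2

/-- The bounded continuous test functional `γ ↦ min 1 (dist (e γ) p)` for a continuous
endpoint map `e` (source or target). -/
def endDistBCF (e : CurveClass ℂ → ℂ) (he : Continuous e) (p : ℂ) :
    BoundedContinuousFunction (CurveClass ℂ) ℝ :=
  BoundedContinuousFunction.ofNormedAddCommGroup (fun γ => min 1 (dist (e γ) p))
    (continuous_const.min (he.dist continuous_const)) 1
    (fun γ => by
      rw [Real.norm_eq_abs, abs_of_nonneg (le_min zero_le_one dist_nonneg)]
      exact min_le_left _ _)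

@[simp] theorem endDistBCF_apply (e : CurveClass ℂ → ℂ) (he : Continuous e) (p : ℂ)
    (γ : CurveClass ℂ) : endDistBCF e he p γ = min 1 (dist (e γ) p) := rfl

theorem min_one_add_min_one_ge {a b c : ℝ} (ha : 0 ≤ a) (hb : 0 ≤ b) (h : c ≤ a + b) :
    min 1 c ≤ min 1 a + min 1 b := by
  rcases le_total 1 a with h1 | h1
  · rw [min_eq_left h1]
    have : 0 ≤ min 1 b := le_min zero_le_one hb
    exact (min_le_left _ _).trans (by linarith)
  · rcases le_total 1 b with h2 | h2
    · rw [min_eq_left h2]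
      have : 0 ≤ min 1 a := le_min zero_le_one ha
      exact (min_le_left _ _).trans (by linarith)
    · rw [min_eq_right h1, min_eq_right h2]
      exact (min_le_right _ _).trans h

/-- **Orientation is load-bearing.**  Let `X δ` (eventually measurable, under probability laws)
converge in law to an SLE curve `Γ` of the Dobrushin domain `D`, and let `Y δ` be ANY family whose
curves start where the `X δ` curves end (`(Y δ ω).source = (X δ ω).target`, e.g. the time
reversals).  Then `Y` converges in law to NO SLE curve of `D` (any `κ'`).  Proof: the functionals
`min 1 (dist target b)` along `X` and `min 1 (dist source a)` along `Y` both tend to `0`, but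
their sum is pointwise `≥ min 1 (dist a b) > 0` (`a ≠ b` for a Dobrushin domain). -/
theorem not_tendstoLaw_of_source_eq_target {Ωδ : ℝ → Type*} [∀ δ, MeasurableSpace (Ωδ δ)]
    (X Y : ∀ δ, Ωδ δ → CurveClass ℂ) (P : ∀ δ, Measure (Ωδ δ)) [∀ δ, IsProbabilityMeasure (P δ)]
    (hX : ∀ᶠ δ in 𝓝[>] (0 : ℝ), Measurable (X δ))
    (hXY : ∀ δ ω, (Y δ ω).source = (X δ ω).target)
    {κ κ' : ℝ≥0} {D : DobrushinDomain} {Γ Γ' : (ℝ≥0 → ℝ) → CurveClass ℂ}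
    (hΓ : IsSLECurve κ D Γ) (hΓ' : IsSLECurve κ' D Γ')
    (hT : TendstoLaw X P Γ Literature.Probability.Process.preWienerMeasure) :
    ¬ TendstoLaw Y P Γ' Literature.Probability.Process.preWienerMeasure := by
  intro hT'
  set a := D.pt 0 with ha
  set b := D.pt 1 with hb
  have hab : a ≠ b := D.pt_injective.ne (by decide : (0 : Fin 2) ≠ 1)
  set f := endDistBCF CurveClass.target CurveClass.continuous_target b with hf
  set g := endDistBCF CurveClass.source CurveClass.continuous_source a with hg
  -- limits: both integrals tend to 0
  have hlimf : Tendsto (fun δ => ∫ ω, f (X δ ω) ∂P δ) (𝓝[>] (0 : ℝ)) (𝓝 0) := by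
    have h := hT f
    have h0 : ∫ ω, f (Γ ω) ∂Literature.Probability.Process.preWienerMeasure = 0 := by
      apply integral_eq_zero_of_ae
      filter_upwards [target_sle_ae hΓ] with ω hω
      simp [hf, hω, hb]
    rwa [h0] at h
  have hlimg : Tendsto (fun δ => ∫ ω, g (Y δ ω) ∂P δ) (𝓝[>] (0 : ℝ)) (𝓝 0) := by
    have h := hT' g
    have h0 : ∫ ω, g (Γ' ω) ∂Literature.Probability.Process.preWienerMeasure = 0 := by
      apply integral_eq_zero_of_ae
      filter_upwards [source_sle_ae hΓ'] with ω hω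
      simp [hg, hω, ha]
    rwa [h0] at h
  -- pointwise lower bound of the sum
  set m : ℝ := min 1 (dist a b) with hm
  have hm_pos : 0 < m := lt_min one_pos (dist_pos.2 hab)
  -- rewrite the `g ∘ Y`-integrand as a function of `X` (so only `X` needs to be measurable)
  set g' := endDistBCF CurveClass.target CurveClass.continuous_target a with hg'
  have hgg' : ∀ δ ω, g (Y δ ω) = g' (X δ ω) := by
    intro δ ω
    rw [hg, hg', endDistBCF_apply, endDistBCF_apply, hXY δ ω]
  have hpt : ∀ δ ω, m ≤ f (X δ ω) + g' (X δ ω) := by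
    intro δ ω
    rw [hf, hg', endDistBCF_apply, endDistBCF_apply]
    refine min_one_add_min_one_ge dist_nonneg dist_nonneg ?_
    calc dist a b ≤ dist a (X δ ω).target + dist (X δ ω).target b := dist_triangle _ _ _
      _ = dist (X δ ω).target b + dist (X δ ω).target a := by rw [dist_comm a, add_comm]
  have hbd : ∀ (F : BoundedContinuousFunction (CurveClass ℂ) ℝ), (∀ γ, 0 ≤ F γ) → (∀ γ, F γ ≤ 1) →
      ∀ δ, Measurable (X δ) → Integrable (fun ω => F (X δ ω)) (P δ) := by
    intro F h0 h1 δ hXδ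
    exact Integrable.of_bound (F.continuous.measurable.comp hXδ).aestronglyMeasurable 1
      (Eventually.of_forall fun ω => by rw [Real.norm_eq_abs, abs_of_nonneg (h0 _)]; exact h1 _)
  have hf0 : ∀ γ, 0 ≤ f γ := fun γ => le_min zero_le_one dist_nonneg
  have hf1 : ∀ γ, f γ ≤ 1 := fun γ => min_le_left _ _
  have hg0 : ∀ γ, 0 ≤ g' γ := fun γ => le_min zero_le_one dist_nonneg
  have hg1 : ∀ γ, g' γ ≤ 1 := fun γ => min_le_left _ _
  -- eventually `m ≤ ∫ f X + ∫ g Y`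
  have hev : ∀ᶠ δ in 𝓝[>] (0 : ℝ), m ≤ ∫ ω, f (X δ ω) ∂P δ + ∫ ω, g (Y δ ω) ∂P δ := by
    filter_upwards [hX] with δ hXδ
    have hfi := hbd f hf0 hf1 δ hXδ
    have hgi := hbd g' hg0 hg1 δ hXδ
    have hcongr : ∫ ω, g (Y δ ω) ∂P δ = ∫ ω, g' (X δ ω) ∂P δ :=
      integral_congr_ae (Eventually.of_forall fun ω => hgg' δ ω)
    rw [hcongr, ← integral_add hfi hgi]
    calc m = ∫ _ω, m ∂P δ := by rw [integral_const, probReal_univ, one_smul]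
      _ ≤ ∫ ω, (f (X δ ω) + g' (X δ ω)) ∂P δ :=
          integral_mono (integrable_const m) (hfi.add hgi) fun ω => hpt δ ω
  have hsum : Tendsto (fun δ => ∫ ω, f (X δ ω) ∂P δ + ∫ ω, g (Y δ ω) ∂P δ) (𝓝[>] (0 : ℝ))
      (𝓝 0) := by simpa using hlimf.add hlimg
  have hev' : ∀ᶠ δ in 𝓝[>] (0 : ℝ), ∫ ω, f (X δ ω) ∂P δ + ∫ ω, g (Y δ ω) ∂P δ < m :=
    (tendsto_order.1 hsum).2 _ hm_pos
  obtain ⟨δ, h1, h2⟩ := (hev.and hev').exists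
  exact absurd h2 (not_lt.2 h1)


/-- The crux's interface map with the OPPOSITE endpoint rule (the two branches swapped). -/
def interfaceMapRev (D : DobrushinDomain) (E : DiscreteDobrushin) (ω : BondConfig (Site 2)) :
    CurveClass ℂ :=
  CurveClass.mk (if dist (medialExplorationCurve E ω 0) (D.pt 0) ≤
      dist (medialExplorationCurve E ω 0) (D.pt 1) then
    (⟨(medialExplorationCurve E ω).comp ⟨unitInterval.symm, unitInterval.continuous_symm⟩⟩ : Curve ℂ)
    else ⟨medialExplorationCurve E ω⟩)

/-- The reversed map starts where the crux's map ends. -/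
theorem source_interfaceMapRev (D : DobrushinDomain) (E : DiscreteDobrushin)
    (ω : BondConfig (Site 2)) :
    (interfaceMapRev D E ω).source = (interfaceMap D E ω).target := by
  unfold interfaceMapRev interfaceMap
  split_ifs with h
  · rw [CurveClass.source_mk, CurveClass.target_mk, Curve.source_def, Curve.target_def]
    show medialExplorationCurve E ω (unitInterval.symm 0) = medialExplorationCurve E ω 1
    rw [unitInterval.symm_zero]
  · rw [CurveClass.source_mk, CurveClass.target_mk, Curve.source_def, Curve.target_def]
    show medialExplorationCurve E ω 0 = medialExplorationCurve E ω (unitInterval.symm 1)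
    rw [unitInterval.symm_one]

/-- `SLE6Families` with the endpoint rule reversed. -/
def SLE6FamiliesRev : Prop :=
  ∀ (D : DobrushinDomain) (Λ : ℝ → DiscreteDobrushin), (∀ δ, (Λ δ).Ω = D.carrier) →
    (∀ δ, (Λ δ).δ = δ) →
    Tendsto (fun δ : ℝ => Metric.hausdorffEDist (Λ δ).arcA (D.arc 0)) (𝓝[>] (0:ℝ)) (𝓝 0) →
    Tendsto (fun δ : ℝ => Metric.hausdorffEDist (Λ δ).arcB (D.arc 1)) (𝓝[>] (0:ℝ)) (𝓝 0) →
    Tendsto (fun δ : ℝ => Metric.hausdorffEDist (medialPoint δ '' (Λ δ).zdABEdges) {D.pt 0, D.pt 1})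
      (𝓝[>] (0:ℝ)) (𝓝 0) →
    (∀ᶠ δ in 𝓝[>] (0:ℝ), (Λ δ).IsZdAdmissible) →
    ConvergesInLawToSLE 6 D (Ωδ := fun _ => BondConfig (Site 2)) (fun δ ω => interfaceMapRev D (Λ δ) ω)
      (fun _ => bondPercolation (zdGraph 2) half)

/-- **LOAD-BEARING (orientation).**  Under the antecedent, the antecedent with the endpoint rule
reversed is FALSE (witness: the tree's disc family; functionals `min 1 (dist target b)` and
`min 1 (dist source a)`). Any proof of the crux from `SLE6Families` that were insensitive to the
orientation convention would prove it from `SLE6FamiliesRev` too — it cannot exist. -/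
theorem orientation_loadBearing (h : SLE6Families) : ¬ SLE6FamiliesRev := by
  intro hrev
  obtain ⟨Γ, hΓ, -, hT⟩ := sle6Families_instance h
  obtain ⟨Γ', hΓ', -, hT'⟩ := hrev _ _ familyHyps_discData.Ω_eq familyHyps_discData.δ_eq
    familyHyps_discData.tendsto_arcA familyHyps_discData.tendsto_arcB
    familyHyps_discData.tendsto_zdABEdges familyHyps_discData.eventually_isZdAdmissible
  exact not_tendstoLaw_of_source_eq_target
    (fun δ ω => interfaceMap DobrushinDomain.unitDisc (UnitDiscDiscretisation.discData δ) ω)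
    (fun δ ω => interfaceMapRev DobrushinDomain.unitDisc (UnitDiscDiscretisation.discData δ) ω)
    (fun _ => bondPercolation (zdGraph 2) half)
    (eventually_nhdsWithin_of_forall fun δ hδ =>
      measurable_interfaceMap_of_family _ _ familyHyps_discData hδ)
    (fun δ ω => source_interfaceMapRev _ _ ω) hΓ hΓ' hT hT'

/-! ### §3 The discrete dictionary (why-might-fail #1), typed -/

/-- "The oriented list `l` of medial vertices touches the site set `S` strictly before the site
set `T`": some entry with an endpoint in `S` precedes every entry with an endpoint in `T`. -/
def TouchesBefore (l : List MedialVertex) (S T : Set (Site 2)) : Prop :=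
  ∃ k : ℕ, (∃ e, l[k]? = some e ∧ ∃ x ∈ e, x ∈ S) ∧
    ∀ j ≤ k, ∀ e, l[j]? = some e → ∀ x ∈ e, x ∉ T

/-- The DISCRETE DICTIONARY for provers, `→` half (cycle-2 finding; PROVED in §4,
`exactDictionary_holds`).  Data: admissible `E`; ANY splitting of the wired arc sites `zdArcA = A₁ ∪ A₂`
(disjoint) and of the dual-wired arc sites `zdArcB = B₁ ∪ B₂`; an exploration list `γ` read in
either direction `l`, starting at an edge with an `A₁` endpoint and a `B₂` endpoint.  Then

  `l` touches `B₁` strictly before `A₂`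
    `→` some site of `A₁` is joined to some site `u ∉ A₂ ∪ zdArcB`, by a path of
        `bcBondConfig`-open edges none of whose vertices lies in `A₂`, with `u` adjacent in `Ω_δ`
        to a site of `B₁`.

Proof (§4): the left corner vertices of the steps of `γ`
inside the initial segment of `l` up to the first `B₁`-touch are endpoints of the visited medial
vertices (`IsLeftVertexAt.mem`), hence avoid `A₂`; they are chained by open edges
(`left_reachable`, read forwards if `l = γ`, backwards if `l = γ.reverse`); the chain starts at
the `A`-endpoint of the head (the `B`-endpoint carries no open edge, `Disjoint zdArcA zdArcB`), and
ends at the non-`B` endpoint `u` of the touching medial vertex `{u, y}`, `y ∈ B₁`, a side of an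
inner face, hence an edge of `Ω_δ`.

CONVERSE (`←`, the planar BARRIER argument: the open path plus the closed edge `{u, y}` separates
the head edge from the `A₂` sites in the face domain; `γ` crosses no open edge and visits no
`B`–`B` edge) holds for ARC splittings — `A₂`, `B₁` the discrete sub-arcs beyond the marked points
`b`, `d` of a conformal rectangle `(Ω; a, b, c, d)` discretising the Dobrushin domain `(Ω; a, c)` —
and was TESTED EXACT (0 mismatches) on every configuration of the local smoke runs (square and 2:1
rectangle families, meshes 1/4 … 1/16, ≈ 7·10⁵ configurations incl. the full enumeration at 1/4;
kit job j006753 extends the test to 1/256).  It is FALSE for arbitrary splittings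
(move one bottom-row site next to the start into `A₂`: the wired crossing survives, the hitting
event dies), so no splitting-free converse should be filed.  The FREE crossing event
`discreteCrossing` of the summit differs from the wired event only through (i) the wired `A₁`
edges, (ii) paths through `A₂`/`B₂` sites, (iii) the last edge into `B₁` — boundary 3-arm events,
measured `P(C₁ xor H) ≈ 1.45 δ` on the square. -/
def ExactDictionary : Prop :=
  ∀ (E : DiscreteDobrushin), E.IsZdAdmissible →
  ∀ (A₁ A₂ B₁ B₂ : Set (Site 2)), A₁ ∪ A₂ = E.zdArcA → Disjoint A₁ A₂ → B₁ ∪ B₂ = E.zdArcB →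
  ∀ (ω : BondConfig (Site 2)) (γ : List MedialVertex), IsMedialExploration E ω γ →
  ∀ (l : List MedialVertex), (l = γ ∨ l = γ.reverse) →
    (∃ e, l.head? = some e ∧ (∃ x ∈ e, x ∈ A₁) ∧ ∃ y ∈ e, y ∈ B₂) →
    TouchesBefore l B₁ A₂ →
      ∃ x ∈ A₁, ∃ u, u ∉ A₂ ∧ u ∉ E.zdArcB ∧ (∃ y ∈ B₁, (discreteDomainGraph E.Ω E.δ).Adj u y) ∧
        (SimpleGraph.fromRel (fun p q : Site 2 => s(p, q) ∈ E.bcBondConfig ω ∧ p ∉ A₂ ∧ q ∉ A₂)).Reachable x u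

/-- DUALITY-STEP ALGEBRA (for the skeleton of gen-1 §5): for any two events of a probability
space, `P C₁ + P C₂ = 1 + P (C₁ ∩ C₂) - P (C₁ᶜ ∩ C₂ᶜ)`.  With `C₁`, `C₂` the two FREE crossings of a
conformal rectangle this says that `p + q ≤ 1 + ε` is an open-plus versus closed-plus comparison
(`P(C₁ ∩ C₂) ≤ P(C₁ᶜ ∩ C₂ᶜ) + ε`; measured `≈ +1.5 δ` on the square, meshes 1/4 … 1/16), not a consequence
of lattice duality — whereas for COMPLEMENTARY events (`C₂ := C₁ᶜ` up to junk: the closed-dual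
conjugate crossing, or the other first-touch event of the same interface) it is free. -/
theorem prob_add_prob_eq {Ω : Type*} [MeasurableSpace Ω] (P : Measure Ω) [IsProbabilityMeasure P]
    {C₁ C₂ : Set Ω} (h₁ : MeasurableSet C₁) (h₂ : MeasurableSet C₂) :
    P.real C₁ + P.real C₂ = 1 + P.real (C₁ ∩ C₂) - P.real (C₁ᶜ ∩ C₂ᶜ) := by
  have hu : P.real (C₁ ∪ C₂) + P.real (C₁ ∩ C₂) = P.real C₁ + P.real C₂ :=
    measureReal_union_add_inter h₂
  have hc : P.real (C₁ ∪ C₂) + P.real (C₁ ∪ C₂)ᶜ = 1 := by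
    rw [measureReal_add_measureReal_compl (h₁.union h₂), probReal_univ]
  rw [Set.compl_union] at hc
  linarith

/-- LIMINF-ONLY BOOKKEEPING with complementary events (variant of gen-1's
`crossing_limit_of_two_liminf_bounds` in which `p + q ≤ 1` is automatic): if `p δ + q δ ≤ 1`
for all `δ` (e.g. `p`, `q` the probabilities of two DISJOINT events), `liminf p ≥ F` and
`liminf q ≥ 1 - F` in the `ε`-form, then `p → F`. -/
theorem limit_of_liminf_of_compl {p q : ℝ → ℝ} {F : ℝ} (hpq : ∀ δ, p δ + q δ ≤ 1)
    (hp : ∀ ε > 0, ∀ᶠ δ in 𝓝[>] (0 : ℝ), F - ε ≤ p δ)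
    (hq : ∀ ε > 0, ∀ᶠ δ in 𝓝[>] (0 : ℝ), 1 - F - ε ≤ q δ) :
    Tendsto p (𝓝[>] (0 : ℝ)) (𝓝 F) := by
  rw [Metric.tendsto_nhds]
  intro ε hε
  filter_upwards [hp (ε / 2) (half_pos hε), hq (ε / 2) (half_pos hε)] with δ h1 h2
  rw [Real.dist_eq, abs_lt]
  have := hpq δ
  constructor <;> linarith

/-! ### §4 The `→` half of the dictionary, PROVED (positive by-products for provers)

`exactDictionary_holds : ExactDictionary` below is a complete proof from the definitions of
`MedialInterface.lean` alone (no well-definedness fact, no planarity): ingredients are the corner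
bookkeeping fact `IsCorner.eq_of_cornerSource_eq_of_cornerTarget_eq` (a named fact there,
"sorried: finite coordinate bookkeeping" — DISCHARGED as
`isCorner_eq_of_cornerSource_eq_of_cornerTarget_eq_holds`; a prover may land it verbatim as the
`_holds` theorem, which also yields `IsMedialDart.existsUnique_corner` by the interim proof kept in
that file), the LEFT-CLUSTER INDUCTION `left_chain` / `left_reachable` (along any list satisfying
`IsMedialExploration E ω γ`, consecutive left corner vertices are equal or joined by the then
`bcBondConfig`-open medial vertex between them), `not_mem_zdArcB_of_reachable` (sites of the
dual-wired arc carry no open edge) and `domAdj_of_isMedialStep` (medial vertices of steps are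
edges of `Ω_δ`).  The two orientations `l = γ` / `l = γ.reverse` of the crux's endpoint rule are
both covered (forward window `[0, k-1]`, backward window `[m, length-2]`). -/

/-! #### Corner bookkeeping -/

theorem coord_eq {x y : Site 2} (h : x = y) : x 0 = y 0 ∧ x 1 = y 1 := by subst h; exact ⟨rfl, rfl⟩

@[simp] theorem cornerNeighbor_zero_zero (v f : Site 2) :
    cornerNeighbor v f 0 0 = 2 * f 0 + 1 - v 0 := by simp [cornerNeighbor]

@[simp] theorem cornerNeighbor_zero_one (v f : Site 2) : cornerNeighbor v f 0 1 = v 1 := by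
  simp [cornerNeighbor]

@[simp] theorem cornerNeighbor_one_one (v f : Site 2) :
    cornerNeighbor v f 1 1 = 2 * f 1 + 1 - v 1 := by simp [cornerNeighbor]

@[simp] theorem cornerNeighbor_one_zero (v f : Site 2) : cornerNeighbor v f 1 0 = v 0 := by
  simp [cornerNeighbor]

theorem isCorner_eq_of_cornerSource_eq_of_cornerTarget_eq_holds :
    IsCorner.eq_of_cornerSource_eq_of_cornerTarget_eq := by
  intro v f v' f' hv hv' hs ht
  have h0 := hv 0; have h1 := hv 1; have h0' := hv' 0; have h1' := hv' 1
  suffices H : v 0 = v' 0 ∧ v 1 = v' 1 ∧ f 0 = f' 0 ∧ f 1 = f' 1 by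
    obtain ⟨a, b, c, d⟩ := H
    refine ⟨funext fun i => ?_, funext fun i => ?_⟩ <;> fin_cases i <;> assumption
  simp only [cornerSource, cornerTarget, cornerEdge] at hs ht
  split_ifs at hs ht with hd hd' hd' <;>
  · rw [Sym2.eq_iff] at hs ht
    rcases hs with ⟨hs1, hs2⟩ | ⟨hs1, hs2⟩ <;> rcases ht with ⟨ht1, ht2⟩ | ⟨ht1, ht2⟩ <;>
    · have a := coord_eq hs1; have b := coord_eq hs2; have c := coord_eq ht1; have d := coord_eq ht2
      simp only [cornerNeighbor_zero_zero, cornerNeighbor_zero_one, cornerNeighbor_one_one,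
        cornerNeighbor_one_zero] at a b c d
      omega

/-- Discharge of the companion named fact `IsMedialDart.existsUnique_corner` (the interim proof kept
in `MedialInterface.lean`, re-instated over the discharged corner fact): the corner carrying a
medial dart is unique. -/
theorem isMedialDart_existsUnique_corner_holds : IsMedialDart.existsUnique_corner := by
  intro e e' h
  obtain ⟨v, f, hv, rfl, rfl⟩ := h
  refine ⟨(v, f), ⟨hv, rfl, rfl⟩, ?_⟩
  rintro ⟨v', f'⟩ ⟨hv', hs, ht⟩
  obtain ⟨rfl, rfl⟩ :=
    isCorner_eq_of_cornerSource_eq_of_cornerTarget_eq_holds hv' hv hs ht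
  rfl

theorem mem_cornerSource (v f : Site 2) : v ∈ cornerSource v f := by
  unfold cornerSource cornerEdge
  split_ifs <;> exact Sym2.mem_mk_left _ _

theorem mem_cornerTarget (v f : Site 2) : v ∈ cornerTarget v f := by
  unfold cornerTarget cornerEdge
  split_ifs <;> exact Sym2.mem_mk_left _ _

theorem cornerTarget_eq_mk (v f : Site 2) : ∃ n, cornerTarget v f = s(v, n) := by
  unfold cornerTarget cornerEdge
  split_ifs
  · exact ⟨_, rfl⟩
  · exact ⟨_, rfl⟩

theorem cornerSource_eq_cornerEdge (v f : Site 2) : ∃ i, cornerSource v f = cornerEdge v f i := by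
  unfold cornerSource; split_ifs; exacts [⟨0, rfl⟩, ⟨1, rfl⟩]

theorem cornerTarget_eq_cornerEdge (v f : Site 2) : ∃ i, cornerTarget v f = cornerEdge v f i := by
  unfold cornerTarget; split_ifs; exacts [⟨1, rfl⟩, ⟨0, rfl⟩]

/-- The neighbour of a corner along a side is again a corner of the face. -/
theorem isCorner_cornerNeighbor {v f : Site 2} (hv : IsCorner v f) (i : Fin 2) :
    IsCorner (cornerNeighbor v f i) f := by
  intro j
  by_cases hj : j = i
  · subst hj
    rcases hv j with h | h
    · right; simp [cornerNeighbor, h]; ring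
    · left; simp [cornerNeighbor, h]; ring
  · simp only [cornerNeighbor, Function.update_of_ne hj]
    exact hv j

/-- A corner and its neighbour along a side are `ℤ²`-adjacent. -/
theorem zdAdj_cornerNeighbor {v f : Site 2} (hv : IsCorner v f) (i : Fin 2) :
    (zdGraph 2).Adj v (cornerNeighbor v f i) := by
  rw [zdGraph_adj_iff]
  refine ⟨i, ?_⟩
  rcases hv i with h | h
  · left
    funext j
    by_cases hj : j = i
    · subst hj; simp [cornerNeighbor, h]; ring
    · simp [cornerNeighbor, hj]
  · right
    funext j
    by_cases hj : j = i
    · subst hj; simp [cornerNeighbor, h]; ring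
    · simp [cornerNeighbor, hj]

/-- The sides of an inner face are edges of the discrete domain. -/
theorem domAdj_cornerEdge {D : DiscreteDobrushin} {v f : Site 2} (hv : IsCorner v f)
    (hf : D.IsInnerFace f) (i : Fin 2) :
    (discreteDomainGraph D.Ω D.δ).Adj v (cornerNeighbor v f i) :=
  hf v _ hv (isCorner_cornerNeighbor hv i) (zdAdj_cornerNeighbor hv i)

/-- Both medial vertices of a medial step are edges of `Ω_δ`: every two distinct endpoints of
either are `Ω_δ`-adjacent. -/
theorem domAdj_of_isMedialStep {D : DiscreteDobrushin} {e e' : MedialVertex}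
    (h : D.IsMedialStep e e') {a b : Site 2} (hab : a ≠ b) (ha : a ∈ e ∨ a ∈ e')
    (hb : (a ∈ e ∧ b ∈ e) ∨ (a ∈ e' ∧ b ∈ e')) :
    (discreteDomainGraph D.Ω D.δ).Adj a b := by
  obtain ⟨v, f, hv, hf, hs, ht⟩ := h
  have key : ∀ i : Fin 2, a ∈ cornerEdge v f i → b ∈ cornerEdge v f i →
      (discreteDomainGraph D.Ω D.δ).Adj a b := by
    intro i hai hbi
    have hadj := domAdj_cornerEdge hv hf i
    have hne : v ≠ cornerNeighbor v f i := hadj.ne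
    rw [cornerEdge, Sym2.mem_iff] at hai hbi
    rcases hai with rfl | rfl <;> rcases hbi with rfl | rfl
    · exact (hab rfl).elim
    · exact hadj
    · exact hadj.symm
    · exact (hab rfl).elim
  clear ha
  obtain ⟨i, hi⟩ := cornerSource_eq_cornerEdge v f
  obtain ⟨j, hj⟩ := cornerTarget_eq_cornerEdge v f
  rcases hb with ⟨ha, hb⟩ | ⟨ha, hb⟩
  · rw [← hs, hi] at ha hb; exact key i ha hb
  · rw [← ht, hj] at ha hb; exact key j ha hb

/-! #### Infixes and prefixes from indices -/

theorem take_two_eq {α : Type*} (l : List α) (k : ℕ) {a b : α}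
    (ha : l[k]? = some a) (hb : l[k + 1]? = some b) : (l.drop k).take 2 = [a, b] := by
  apply List.ext_getElem?
  intro i
  rw [List.getElem?_take]
  split_ifs with hi
  · rw [List.getElem?_drop]
    interval_cases i
    · simpa using ha
    · simpa using hb
  · have : ([a, b] : List α)[i]? = none := List.getElem?_eq_none (by simp; omega)
    rw [this]

theorem infix_two {α : Type*} (l : List α) (k : ℕ) {a b : α}
    (ha : l[k]? = some a) (hb : l[k + 1]? = some b) : [a, b] <:+: l := by
  rw [← take_two_eq l k ha hb]
  exact (List.take_prefix 2 (l.drop k)).isInfix.trans (List.drop_suffix k l).isInfix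

theorem prefix_two {α : Type*} (l : List α) {a b : α}
    (ha : l[0]? = some a) (hb : l[1]? = some b) : [a, b] <+: l := by
  have h := take_two_eq l 0 ha hb
  rw [List.drop_zero] at h
  rw [← h]
  exact List.take_prefix 2 l

theorem infix_three {α : Type*} (l : List α) (k : ℕ) {a b c : α}
    (ha : l[k]? = some a) (hb : l[k + 1]? = some b) (hc : l[k + 2]? = some c) :
    [a, b, c] <:+: l := by
  have h : (l.drop k).take 3 = [a, b, c] := by
    apply List.ext_getElem?
    intro i
    rw [List.getElem?_take]
    split_ifs with hi
    · rw [List.getElem?_drop]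
      interval_cases i
      · simpa using ha
      · simpa using hb
      · simpa using hc
    · have : ([a, b, c] : List α)[i]? = none := List.getElem?_eq_none (by simp; omega)
      rw [this]
  rw [← h]
  exact (List.take_prefix 3 (l.drop k)).isInfix.trans (List.drop_suffix k l).isInfix

/-! #### Left corner vertices of an exploration -/

variable {E : DiscreteDobrushin} {ω : BondConfig (Site 2)} {γ : List MedialVertex}

def IsLeftVertexAt (γ : List MedialVertex) (k : ℕ) (v : Site 2) : Prop :=
  ∃ (f : Site 2) (e e' : MedialVertex), γ[k]? = some e ∧ γ[k + 1]? = some e' ∧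
    IsCorner v f ∧ cornerSource v f = e ∧ cornerTarget v f = e'

theorem exists_isLeftVertexAt (hγ : IsMedialExploration E ω γ) {k : ℕ} (hk : k + 1 < γ.length) :
    ∃ v, IsLeftVertexAt γ k v := by
  obtain ⟨e, he⟩ : ∃ e, γ[k]? = some e := ⟨γ[k], List.getElem?_eq_getElem (by omega)⟩
  obtain ⟨e', he'⟩ : ∃ e', γ[k + 1]? = some e' := ⟨γ[k + 1], List.getElem?_eq_getElem hk⟩
  obtain ⟨v, f, hv, -, hs, ht⟩ := hγ.step e e' (infix_two γ k he he')
  exact ⟨v, f, e, e', he, he', hv, hs, ht⟩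

theorem IsLeftVertexAt.unique {k : ℕ} {v w : Site 2} (hv : IsLeftVertexAt γ k v)
    (hw : IsLeftVertexAt γ k w) : v = w := by
  obtain ⟨f, e, e', he, he', hvc, hs, ht⟩ := hv
  obtain ⟨g, d, d', hd, hd', hwc, hs', ht'⟩ := hw
  rw [he] at hd; rw [he'] at hd'
  cases hd; cases hd'
  exact (isCorner_eq_of_cornerSource_eq_of_cornerTarget_eq_holds hvc hwc (hs.trans hs'.symm)
    (ht.trans ht'.symm)).1

theorem IsLeftVertexAt.mem {k : ℕ} {v : Site 2} (hv : IsLeftVertexAt γ k v) :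
    ∃ e e', γ[k]? = some e ∧ γ[k + 1]? = some e' ∧ v ∈ e ∧ v ∈ e' := by
  obtain ⟨f, e, e', he, he', -, hs, ht⟩ := hv
  exact ⟨e, e', he, he', hs ▸ mem_cornerSource v f, ht ▸ mem_cornerTarget v f⟩

theorem IsLeftVertexAt.lt_length {k : ℕ} {v : Site 2} (hv : IsLeftVertexAt γ k v) :
    k + 1 < γ.length := by
  obtain ⟨-, -, e', -, he', -⟩ := hv
  exact (List.getElem?_eq_some_iff.1 he').1

/-- The step of a left vertex is a medial step of the domain (inner face). -/
theorem IsLeftVertexAt.isMedialStep (hγ : IsMedialExploration E ω γ) {k : ℕ} {v : Site 2}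
    (hv : IsLeftVertexAt γ k v) :
    ∃ e e', γ[k]? = some e ∧ γ[k + 1]? = some e' ∧ E.IsMedialStep e e' ∧ v ∈ e ∧ v ∈ e' := by
  obtain ⟨f, e, e', he, he', -, hs, ht⟩ := hv
  exact ⟨e, e', he, he', hγ.step e e' (infix_two γ k he he'), hs ▸ mem_cornerSource v f,
    ht ▸ mem_cornerTarget v f⟩

/-- The left vertex of the FIRST step lies on the wired arc (the `start` field). -/
theorem IsLeftVertexAt.mem_zdArcA_zero (hγ : IsMedialExploration E ω γ) {v : Site 2}
    (hv : IsLeftVertexAt γ 0 v) : v ∈ E.zdArcA := by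
  obtain ⟨f, e, e', he, he', hvc, hs, ht⟩ := hv
  obtain ⟨w, g, hwc, hws, hwt, hwA⟩ := hγ.start e e' (prefix_two γ he he')
  obtain ⟨rfl, -⟩ := isCorner_eq_of_cornerSource_eq_of_cornerTarget_eq_holds hwc hvc
    (hws.trans hs.symm) (hwt.trans ht.symm)
  exact hwA

theorem left_chain (hγ : IsMedialExploration E ω γ) {k : ℕ} {v w : Site 2}
    (hv : IsLeftVertexAt γ k v) (hw : IsLeftVertexAt γ (k + 1) w) :
    v = w ∨ ∃ e₁, γ[k + 1]? = some e₁ ∧ s(v, w) = e₁ ∧ e₁ ∈ E.bcBondConfig ω := by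
  obtain ⟨f, e₀, e₁, h0, h1, hvc, hs, ht⟩ := hv
  obtain ⟨g, d₁, e₂, h1', h2, hwc, hs', ht'⟩ := hw
  rw [h1] at h1'
  cases h1'
  obtain ⟨v₁, f₁, v₂, f₂, hc₁, hs₁, ht₁, hc₂, hs₂, ht₂, hturn⟩ :=
    hγ.turn e₀ e₁ e₂ (infix_three γ k h0 h1 h2)
  obtain ⟨rfl, rfl⟩ :=
    isCorner_eq_of_cornerSource_eq_of_cornerTarget_eq_holds hc₁ hvc (hs₁.trans hs.symm)
      (ht₁.trans ht.symm)
  obtain ⟨rfl, rfl⟩ :=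
    isCorner_eq_of_cornerSource_eq_of_cornerTarget_eq_holds hc₂ hwc (hs₂.trans hs'.symm)
      (ht₂.trans ht'.symm)
  rcases hturn with ⟨hvw, -⟩ | ⟨-, hopen⟩
  · exact Or.inl hvw
  · obtain ⟨n, hn⟩ := cornerTarget_eq_mk v₁ f₁
    have hmem : v₂ ∈ e₁ := hs₂ ▸ mem_cornerSource v₂ f₂
    rw [← ht₁, hn, Sym2.mem_iff] at hmem
    rcases hmem with rfl | rfl
    · exact Or.inl rfl
    · exact Or.inr ⟨e₁, h1, by rw [← ht₁, hn], hopen⟩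

def openGraphOn (E : DiscreteDobrushin) (ω : BondConfig (Site 2)) (P : Site 2 → Prop) :
    SimpleGraph (Site 2) :=
  SimpleGraph.fromRel fun p q => s(p, q) ∈ E.bcBondConfig ω ∧ P p ∧ P q

theorem left_reachable (hγ : IsMedialExploration E ω γ) {k : ℕ} {v : Site 2}
    (hv : IsLeftVertexAt γ k v) :
    ∀ m, k ≤ m → ∀ w, IsLeftVertexAt γ m w →
      (openGraphOn E ω fun x => ∃ j, k ≤ j ∧ j ≤ m ∧ IsLeftVertexAt γ j x).Reachable v w := by
  intro m
  induction m with
  | zero =>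
    intro hk w hw
    obtain rfl : k = 0 := Nat.le_zero.1 hk
    rw [hv.unique hw]
  | succ m ih =>
    intro hk w hw
    rcases Nat.lt_or_eq_of_le hk with hlt | rfl
    · have hlen : m + 1 < γ.length := by have := hw.lt_length; omega
      obtain ⟨u, hu⟩ := exists_isLeftVertexAt hγ hlen
      have hreach := ih (by omega) u hu
      have hmono : (openGraphOn E ω fun x => ∃ j, k ≤ j ∧ j ≤ m ∧ IsLeftVertexAt γ j x) ≤
          openGraphOn E ω fun x => ∃ j, k ≤ j ∧ j ≤ m + 1 ∧ IsLeftVertexAt γ j x := by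
        intro p q h
        rw [openGraphOn, SimpleGraph.fromRel_adj] at h ⊢
        refine ⟨h.1, ?_⟩
        rcases h.2 with ⟨ho, ⟨j, hj1, hj2, hj⟩, ⟨j', hj1', hj2', hj'⟩⟩ |
          ⟨ho, ⟨j, hj1, hj2, hj⟩, ⟨j', hj1', hj2', hj'⟩⟩
        · exact Or.inl ⟨ho, ⟨j, hj1, by omega, hj⟩, ⟨j', hj1', by omega, hj'⟩⟩
        · exact Or.inr ⟨ho, ⟨j, hj1, by omega, hj⟩, ⟨j', hj1', by omega, hj'⟩⟩
      have hreach' := hreach.mono hmono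
      rcases left_chain hγ hu hw with rfl | ⟨e₁, -, he, hopen⟩
      · exact hreach'
      · refine hreach'.trans (SimpleGraph.Adj.reachable ?_)
        rw [openGraphOn, SimpleGraph.fromRel_adj]
        refine ⟨fun h => ?_, Or.inl ⟨he ▸ hopen, ⟨m, by omega, by omega, hu⟩,
          ⟨m + 1, by omega, le_rfl, hw⟩⟩⟩
        subst h
        have hE := (E.bcBondConfig_subset ω) (he ▸ hopen : s(u, u) ∈ E.bcBondConfig ω)
        exact SimpleGraph.irrefl _ ((SimpleGraph.mem_edgeSet _).1 hE)
    · rw [hv.unique hw]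

/-! #### Sites of the dual-wired arc carry no open edge -/

theorem not_mem_of_mem_bcBondConfig (hd : Disjoint E.zdArcA E.zdArcB) {e : Sym2 (Site 2)}
    (he : e ∈ E.bcBondConfig ω) {y : Site 2} (hy : y ∈ E.zdArcB) : y ∉ e := by
  intro hye
  rcases he with ⟨-, hall | ⟨-, hnone⟩⟩
  · exact Set.disjoint_left.1 hd (hall y hye) hy
  · exact hnone y hye hy

/-- In any graph whose edges are `bcBondConfig`-open, a vertex reachable from a vertex off the
dual-wired arc is off the dual-wired arc. -/
theorem not_mem_zdArcB_of_reachable (hd : Disjoint E.zdArcA E.zdArcB) {H : SimpleGraph (Site 2)}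
    (hH : ∀ p q, H.Adj p q → s(p, q) ∈ E.bcBondConfig ω) {a b : Site 2} (h : H.Reachable a b)
    (ha : a ∉ E.zdArcB) : b ∉ E.zdArcB := by
  obtain ⟨p⟩ := h
  induction p with
  | nil => exact ha
  | cons hadj p ih =>
    refine ih (fun hc => ?_)
    exact not_mem_of_mem_bcBondConfig hd (hH _ _ hadj) hc (Sym2.mem_mk_right _ _)

/-! #### The dictionary, `→` half -/

/-- Window lemma: if the medial vertices `γ[lo], …, γ[hi+1]` have no `A₂` endpoint, the left
vertices of the steps `lo ≤ i ≤ j ≤ hi` are joined in the `A₂`-avoiding open graph. -/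
theorem window_reachable (hγ : IsMedialExploration E ω γ) {A₂ : Set (Site 2)} {lo hi : ℕ}
    (hsafe : ∀ i, lo ≤ i → i ≤ hi + 1 → ∀ e, γ[i]? = some e → ∀ x ∈ e, x ∉ A₂)
    {i j : ℕ} (hlo : lo ≤ i) (hij : i ≤ j) (hhi : j ≤ hi) {v w : Site 2}
    (hv : IsLeftVertexAt γ i v) (hw : IsLeftVertexAt γ j w) :
    (SimpleGraph.fromRel (fun p q : Site 2 => s(p, q) ∈ E.bcBondConfig ω ∧ p ∉ A₂ ∧ q ∉ A₂)).Reachable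
      v w := by
  refine (left_reachable hγ hv j hij w hw).mono ?_
  intro p q h
  rw [openGraphOn, SimpleGraph.fromRel_adj] at h
  rw [SimpleGraph.fromRel_adj]
  have notA : ∀ x, (∃ j', i ≤ j' ∧ j' ≤ j ∧ IsLeftVertexAt γ j' x) → x ∉ A₂ := by
    rintro x ⟨j', h1, h2, hx⟩
    obtain ⟨e, -, he, -, hxe, -⟩ := hx.mem
    exact hsafe j' (by omega) (by omega) e he x hxe
  refine ⟨h.1, ?_⟩
  rcases h.2 with ⟨ho, hp, hq⟩ | ⟨ho, hq, hp⟩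
  · exact Or.inl ⟨ho, notA p hp, notA q hq⟩
  · exact Or.inr ⟨ho, notA q hq, notA p hp⟩

theorem length_ge_two (hγ : IsMedialExploration E ω γ) : 2 ≤ γ.length := by
  by_contra h
  rw [not_le] at h
  have hne := hγ.ne_nil
  have h1 : γ.length = 1 := by
    have := List.length_pos_iff.2 hne
    omega
  apply hγ.head_ne_getLast
  obtain ⟨a, rfl⟩ := List.length_eq_one_iff.1 h1
  rfl

/-- **The `→` half of the exact dictionary holds** (for every splitting of the arcs). -/
theorem exactDictionary_holds : ExactDictionary := by
  intro E hE A₁ A₂ B₁ B₂ hA hA12 hB ω γ hγ l hl hhead htouch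
  have hd : Disjoint E.zdArcA E.zdArcB := hE.disjoint
  set G : SimpleGraph (Site 2) :=
    SimpleGraph.fromRel (fun p q : Site 2 => s(p, q) ∈ E.bcBondConfig ω ∧ p ∉ A₂ ∧ q ∉ A₂) with hG
  have hGopen : ∀ p q, G.Adj p q → s(p, q) ∈ E.bcBondConfig ω := by
    intro p q h
    rw [hG, SimpleGraph.fromRel_adj] at h
    rcases h.2 with h' | h'
    · exact h'.1
    · rw [Sym2.eq_swap]; exact h'.1
  have hA₁A : A₁ ⊆ E.zdArcA := fun x hx => hA ▸ Or.inl hx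
  have hB₁B : B₁ ⊆ E.zdArcB := fun x hx => hB ▸ Or.inl hx
  have hB₂B : B₂ ⊆ E.zdArcB := fun x hx => hB ▸ Or.inr hx
  obtain ⟨e₀, he₀, ⟨x₁, hx₁e, hx₁⟩, ⟨y', hy'e, hy'⟩⟩ := hhead
  obtain ⟨k, ⟨eₖ, hek, y, hyek, hyB₁⟩, hsafeL⟩ := htouch
  have hL := length_ge_two hγ
  have hx₁y' : x₁ ≠ y' := fun h => Set.disjoint_left.1 hd (hA₁A hx₁) (h ▸ hB₂B hy')
  have he₀eq : e₀ = s(x₁, y') := (Sym2.mem_and_mem_iff hx₁y').1 ⟨hx₁e, hy'e⟩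
  -- The trivial case `k = 0`: the head itself touches `B₁`; then `u := x₁`.
  -- General tool: conclude from a left vertex `u ∈ γ`-window data.
  -- We treat the two orientations separately.
  rcases hl with hl | hl
  · ---------------------------------------------------------------- forward: `l = γ`
    rw [hl] at he₀ hek hsafeL
    rw [List.head?_eq_getElem?] at he₀
    -- left vertex of step 0 is `x₁`
    obtain ⟨v₀, hv₀⟩ := exists_isLeftVertexAt hγ (k := 0) (by omega)
    have hv₀A : v₀ ∈ E.zdArcA := hv₀.mem_zdArcA_zero hγ
    have hv₀x : v₀ = x₁ := by
      obtain ⟨e, -, he, -, hve, -⟩ := hv₀.mem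
      rw [he₀] at he; cases he
      rw [he₀eq, Sym2.mem_iff] at hve
      rcases hve with h | h
      · exact h
      · exact (Set.disjoint_left.1 hd hv₀A (h ▸ hB₂B hy')).elim
    rcases Nat.eq_zero_or_pos k with rfl | hkpos
    · -- the head touches `B₁` at `y`; `y = y'` necessarily, `u := x₁`
      rw [he₀] at hek; cases hek
      refine ⟨x₁, hx₁, x₁, fun h => Set.disjoint_left.1 hA12 hx₁ h,
        fun h => Set.disjoint_left.1 hd (hA₁A hx₁) h, ⟨y, hyB₁, ?_⟩, SimpleGraph.Reachable.refl _⟩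
      have hxy : x₁ ≠ y := fun h => Set.disjoint_left.1 hd (hA₁A hx₁) (h ▸ hB₁B hyB₁)
      obtain ⟨e, e', he, -, hstep, -, -⟩ := hv₀.isMedialStep hγ
      rw [he₀] at he; cases he
      exact domAdj_of_isMedialStep hstep hxy (Or.inl hx₁e) (Or.inl ⟨hx₁e, hyek⟩)
    · -- `k ≥ 1`: `u` := left vertex of step `k - 1`, whose target is `γ[k]`
      have hklt : k < γ.length := (List.getElem?_eq_some_iff.1 hek).1
      obtain ⟨u, hu⟩ := exists_isLeftVertexAt hγ (k := k - 1) (by omega)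
      have hreach : G.Reachable v₀ u :=
        window_reachable hγ (lo := 0) (hi := k - 1) (fun i _ hi e he x hx => hsafeL i (by omega) e he x hx)
          le_rfl (Nat.zero_le _) le_rfl hv₀ hu
      have huB : u ∉ E.zdArcB :=
        not_mem_zdArcB_of_reachable hd hGopen hreach (fun h => Set.disjoint_left.1 hd hv₀A h)
      obtain ⟨e, e', he, he', hstep, hue, hue'⟩ := hu.isMedialStep hγ
      have hk1 : k - 1 + 1 = k := by omega
      rw [hk1, hek] at he'; cases he'
      have huA₂ : u ∉ A₂ := hsafeL k le_rfl _ hek u hue'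
      have huy : u ≠ y := fun h => huB (h ▸ hB₁B hyB₁)
      refine ⟨x₁, hx₁, u, huA₂, huB, ⟨y, hyB₁, ?_⟩, hv₀x ▸ hreach⟩
      exact domAdj_of_isMedialStep hstep huy (Or.inr hue') (Or.inr ⟨hue', hyek⟩)
  · ---------------------------------------------------------------- backward: `l = γ.reverse`
    rw [hl] at he₀ hek hsafeL
    rw [List.head?_reverse, List.getLast?_eq_getElem?] at he₀
    have hlast : γ[γ.length - 1]? = some e₀ := by simpa using he₀
    -- translate the touching index: `γ.reverse[k] = γ[m]`, `m + k + 1 = length`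
    have hklt : k < γ.length := by
      have := (List.getElem?_eq_some_iff.1 hek).1; simpa using this
    set m := γ.length - 1 - k with hm
    have hmk : k + m + 1 = γ.length := by omega
    have hekm : γ[m]? = some eₖ := by rw [← List.getElem?_reverse' hmk]; exact hek
    have hsafe : ∀ i, m ≤ i → i ≤ γ.length - 1 → ∀ e, γ[i]? = some e → ∀ x ∈ e, x ∉ A₂ := by
      intro i hi1 hi2 e he x hx
      have hji : (γ.length - 1 - i) + i + 1 = γ.length := by omega
      refine hsafeL (γ.length - 1 - i) (by omega) e ?_ x hx
      rw [List.getElem?_reverse' hji]; exact he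
    -- left vertex of the LAST step is `x₁`
    obtain ⟨v₀, hv₀⟩ := exists_isLeftVertexAt hγ (k := 0) (by omega)
    have hv₀A : v₀ ∈ E.zdArcA := hv₀.mem_zdArcA_zero hγ
    obtain ⟨vL, hvL⟩ := exists_isLeftVertexAt hγ (k := γ.length - 2) (by omega)
    have hvLB : vL ∉ E.zdArcB := by
      refine not_mem_zdArcB_of_reachable (ω := ω) hd (H := openGraphOn E ω fun x =>
        ∃ j, 0 ≤ j ∧ j ≤ γ.length - 2 ∧ IsLeftVertexAt γ j x) ?_
        (left_reachable hγ hv₀ _ (Nat.zero_le _) vL hvL) (fun h => Set.disjoint_left.1 hd hv₀A h)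
      intro p q h
      rw [openGraphOn, SimpleGraph.fromRel_adj] at h
      rcases h.2 with h' | h'
      · exact h'.1
      · rw [Sym2.eq_swap]; exact h'.1
    have hvLx : vL = x₁ := by
      obtain ⟨-, e', -, he', -, hve'⟩ := hvL.mem
      have h2 : γ.length - 2 + 1 = γ.length - 1 := by omega
      rw [h2, hlast] at he'; cases he'
      rw [he₀eq, Sym2.mem_iff] at hve'
      rcases hve' with h | h
      · exact h
      · exact (hvLB (h ▸ hB₂B hy')).elim
    rcases Nat.eq_zero_or_pos k with rfl | hkpos
    · -- the head of `l` (= last of `γ`) touches `B₁`; `u := x₁`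
      have hme : m = γ.length - 1 := by omega
      rw [hme, hlast] at hekm; cases hekm
      refine ⟨x₁, hx₁, x₁, fun h => Set.disjoint_left.1 hA12 hx₁ h,
        fun h => Set.disjoint_left.1 hd (hA₁A hx₁) h, ⟨y, hyB₁, ?_⟩, SimpleGraph.Reachable.refl _⟩
      have hxy : x₁ ≠ y := fun h => Set.disjoint_left.1 hd (hA₁A hx₁) (h ▸ hB₁B hyB₁)
      obtain ⟨e, e', -, he', hstep, -, -⟩ := hvL.isMedialStep hγ
      have h2 : γ.length - 2 + 1 = γ.length - 1 := by omega
      rw [h2, hlast] at he'; cases he'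
      exact domAdj_of_isMedialStep hstep hxy (Or.inr hx₁e) (Or.inr ⟨hx₁e, hyek⟩)
    · -- `k ≥ 1`, i.e. `m ≤ length - 2`: `u` := left vertex of step `m` (source `γ[m]`)
      have hmle : m ≤ γ.length - 2 := by omega
      obtain ⟨u, hu⟩ := exists_isLeftVertexAt hγ (k := m) (by omega)
      have hreach : G.Reachable u vL :=
        window_reachable hγ (lo := m) (hi := γ.length - 2)
          (fun i hi1 hi2 e he x hx => hsafe i hi1 (by omega) e he x hx)
          le_rfl hmle le_rfl hu hvL
      have huB : u ∉ E.zdArcB := by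
        intro huB
        have := not_mem_zdArcB_of_reachable hd hGopen hreach.symm (hvLx ▸ fun h =>
          Set.disjoint_left.1 hd (hA₁A hx₁) h)
        exact this huB
      obtain ⟨e, e', he, -, hstep, hue, -⟩ := hu.isMedialStep hγ
      rw [hekm] at he; cases he
      have huA₂ : u ∉ A₂ := hsafe m le_rfl (by omega) _ hekm u hue
      have huy : u ≠ y := fun h => huB (h ▸ hB₁B hyB₁)
      refine ⟨x₁, hx₁, u, huA₂, huB, ⟨y, hyB₁, ?_⟩, hvLx ▸ hreach.symm⟩
      exact domAdj_of_isMedialStep hstep huy (Or.inl hue) (Or.inl ⟨hue, hyek⟩)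


end Summit.CriticalPhenomena.CardyFormulaZ2.Cruxes.SLESixFamiliesGiveCardy.Disproof

end
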